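import Summits.NavierStokesRegularity.NavierStokesRegularity.Theorems.AxisTwistDoorAveragedConeLiouvilleNUFactR3
import Literature.Analysis.FluidPDE.DivFreeDriftPositivityPropagationAffine
import HarnessLib

/-!
# B1′: Nazarov–Ural'tseva propagation of positivity on ARBITRARY parabolic cylinders of `ℝ³` —
# unconditional (the covariant form of the row-A12 fact, instantiated at `E = ℝ³`)

Cell pub/ns-inputs, TABLE A row A5 (`LeiRenTian2025_doubleCone_regularity`, Lei–Ren–Tian 2025 Thm 1.1),
recon memo of record `kits/A5-recon-ser-b.md` §5 («B1′: the unconditional ℝ³ instance from p644110»).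

* B1 = `Literature.Analysis.FluidPDE.NazarovUraltseva2011_positivity_propagation.affine` (p646112): the named
  unit-cylinder fact `NazarovUraltseva2011_positivity_propagation E` ⇒ its parabolically covariant form on every
  cylinder `(t₀, t₀ + R²T) × B(x₀, R)` (drift bound `A/R`, level-set mass `δ Rⁿ`, same `β`), by the change of
  variables of `SpaceTimeRescaling.lean`.
* N4/T1 = `…Theorems.AveragedConeLiouville.NUPositivity.nazarovUraltseva2011_positivity_propagation_R3` (p644110):
  the unit-cylinder fact IS a theorem of the tree at `E = ℝ³` (Lipschitz De Giorgi chain).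

This file composes the two: **`nazarovUraltseva2011_positivity_propagation_R3_affine`** — the covariant statement on
every cylinder of `ℝ³`, with NO named-fact hypothesis.  It is the positivity input that step S4c / design point D4
of the A5 proof map needs (Lei–Ren–Tian 2025 §4: Lemma 2.5 applied "in 𝒟₁, 𝒟₂ viewed as 3D domains" along an
axis-avoiding Harnack chain of shifted/scaled cylinders, to the merely LIPSCHITZ quantity `V = sup Γ − Γ`,
`Γ = ∫_D |ω₃|`), and more generally what any DGNM-with-divergence-free-drift consumer on `ℝ³` needs; the
classical twin `…AveragedConeLiouville.PositivityAffine` (26889) covers only `C²` supersolutions.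
It lives under Theorems because Literature may not import Summits.  Pure theorem: no `def`, named-fact debt 0.

WHAT THIS IS NOT: not a statement about Navier–Stokes regularity; it instantiates a re-proved PRINTED theorem
(Nazarov–Uraltseva 2011 §3 Cor. 3.2 / Lemma 3.4 / Cor. 3.3; Lei–Ren–Tian 2025 Lemma 2.5 and the sentence after
it, "the exact choice of domains in Lemma 2.5 can be rather arbitrary") on `ℝ³`; items 0155 / 15453 and the
summit stay OPEN. [cite: NazarovUraltseva2011HarnackDivFree, §3 Cor 3.2 (arXiv:1011.1888 p.10)]
[cite: LeiRenTian2025, Lemma 2.5 and remark after it (arXiv:2501.08976 p.7)]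
-/

noncomputable section

-- the summit and its single sub-problem share the name (CONVENTIONS §1)
set_option linter.dupNamespace false

open MeasureTheory Set Function Metric Filter Topology
open Literature.Analysis.FluidPDE

namespace Summit.NavierStokesRegularity.NavierStokesRegularity.Theorems.AveragedConeLiouville.NUPositivity

/-- **B1′ — Nazarov–Ural'tseva / Lei–Ren–Tian propagation of positivity on an arbitrary parabolic cylinder of
`ℝ³`, unconditional.**  For all `A ≥ 0`, `δ > 0`, `T > 0`, `0 < r < 1` there is `β > 0` such that for every centre
`x₀ : ℝ³`, initial time `t₀` and radius `R > 0`: every jointly measurable drift `b` with `‖b(t,x)‖ ≤ A/R` on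
`(t₀, t₀ + R²T) × B(x₀, R)` and `∫∫ ⟪b, ∇ₓφ⟫ = 0` for all smooth `φ` compactly supported in that open cylinder,
every `V` Lipschitz and nonnegative on the cylinder which is a generalized supersolution of
`∂ₜV − ΔV + b·∇V = 0` there (against every nonnegative Lipschitz `η` vanishing for `‖x − x₀‖ ≥ ρR` and for
`t ≤ t₀ + R²τ`, some `ρ < 1`, `τ > 0`), every level `λ > 0` and time `t̄ ∈ (t₀, t₀ + R²T/3)` with
`vol {x ∈ B(x₀,R) | λ ≤ V(t̄,x)} ≥ δ R³` satisfy `β λ ≤ V(t,x)` for `t ∈ (t₀ + R²T/2, t₀ + R²T)`,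
`x ∈ B(x₀, rR)`.  Proof: `NazarovUraltseva2011_positivity_propagation.affine` (parabolic covariance, p646112)
applied to the tree's theorem `nazarovUraltseva2011_positivity_propagation_R3` (p644110), `finrank ℝ ℝ³ = 3 ≥ 2`.
[cite: NazarovUraltseva2011HarnackDivFree, §3 Cor 3.2 (arXiv:1011.1888 p.10)]
[cite: LeiRenTian2025, Lemma 2.5 and remark after it (arXiv:2501.08976 p.7)] -/
theorem nazarovUraltseva2011_positivity_propagation_R3_affine
    ⦃A δ T r : ℝ⦄ (hA : 0 ≤ A) (hδ : 0 < δ) (hT : 0 < T) (hr : 0 < r) (hr1 : r < 1) :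
    ∃ β : ℝ, 0 < β ∧ ∀ ⦃x₀ : EuclideanSpace ℝ (Fin 3)⦄ ⦃t₀ R : ℝ⦄, 0 < R →
      ∀ ⦃b : ℝ → EuclideanSpace ℝ (Fin 3) → EuclideanSpace ℝ (Fin 3)⦄
        ⦃V : ℝ → EuclideanSpace ℝ (Fin 3) → ℝ⦄ ⦃lam tbar : ℝ⦄,
      Measurable (uncurry b) →
      (∀ t ∈ Ioo t₀ (t₀ + R ^ 2 * T), ∀ x ∈ ball x₀ R, ‖b t x‖ ≤ A / R) →
      (∀ φ : ℝ → EuclideanSpace ℝ (Fin 3) → ℝ, ContDiff ℝ (⊤ : ℕ∞) (uncurry φ) →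
        HasCompactSupport (uncurry φ) →
        tsupport (uncurry φ) ⊆ Ioo t₀ (t₀ + R ^ 2 * T) ×ˢ ball x₀ R →
        ∫ p in Ioo t₀ (t₀ + R ^ 2 * T) ×ˢ ball x₀ R,
          inner ℝ (b p.1 p.2) (gradient (φ p.1) p.2) = 0) →
      (∃ L, LipschitzOnWith L (uncurry V) (Ioo t₀ (t₀ + R ^ 2 * T) ×ˢ ball x₀ R)) →
      (∀ t ∈ Ioo t₀ (t₀ + R ^ 2 * T), ∀ x ∈ ball x₀ R, 0 ≤ V t x) →
      (∀ η : ℝ → EuclideanSpace ℝ (Fin 3) → ℝ, (∃ K, LipschitzWith K (uncurry η)) → (∀ t x, 0 ≤ η t x) →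
        (∃ ρ τ : ℝ, ρ < 1 ∧ 0 < τ ∧ ∀ t x, (ρ * R ≤ ‖x - x₀‖ ∨ t ≤ t₀ + R ^ 2 * τ) → η t x = 0) →
        0 ≤ ∫ p in Ioo t₀ (t₀ + R ^ 2 * T) ×ˢ ball x₀ R,
          (deriv (fun s => V s p.2) p.1 * η p.1 p.2 +
            inner ℝ (gradient (V p.1) p.2) (gradient (η p.1) p.2) +
            inner ℝ (b p.1 p.2) (gradient (V p.1) p.2) * η p.1 p.2)) →
      0 < lam → tbar ∈ Ioo t₀ (t₀ + R ^ 2 * T / 3) →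
      ENNReal.ofReal (δ * R ^ 3) ≤
        volume {x ∈ ball x₀ R | lam ≤ V tbar x} →
      ∀ ⦃t : ℝ⦄ ⦃x : EuclideanSpace ℝ (Fin 3)⦄, t ∈ Ioo (t₀ + R ^ 2 * T / 2) (t₀ + R ^ 2 * T) →
        x ∈ ball x₀ (r * R) → β * lam ≤ V t x := by
  have hE : 2 ≤ Module.finrank ℝ (EuclideanSpace ℝ (Fin 3)) := by
    rw [finrank_euclideanSpace, Fintype.card_fin]; norm_num
  have h3 : Module.finrank ℝ (EuclideanSpace ℝ (Fin 3)) = 3 := by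
    rw [finrank_euclideanSpace, Fintype.card_fin]
  obtain ⟨β, hβ, H⟩ :=
    NazarovUraltseva2011_positivity_propagation.affine nazarovUraltseva2011_positivity_propagation_R3 hE
      hA hδ hT hr hr1
  refine ⟨β, hβ, ?_⟩
  intro x₀ t₀ R hR b V lam tbar hbm hbA hdiv hVlip hV0 hsup hlam htbar hmeas t x ht hx
  have hmeas' : ENNReal.ofReal (δ * R ^ Module.finrank ℝ (EuclideanSpace ℝ (Fin 3))) ≤
      volume {x ∈ ball x₀ R | lam ≤ V tbar x} := by
    rw [h3]; exact hmeas
  exact H hR hbm hbA hdiv hVlip hV0 hsup hlam htbar hmeas' ht hx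

end Summit.NavierStokesRegularity.NavierStokesRegularity.Theorems.AveragedConeLiouville.NUPositivity

end
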